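import Summits.NavierStokesRegularity.NavierStokesRegularity.Theorems.RellichScarScarRigidityVorticityDefectKinematics
import HarnessLib

/-!
# `ScarRigidity`, line `moment-conditioned-rellich` — stub `stub_vorticityDefectDecay` (V-rung), part 3:
# quintic flatness of the antisymmetric gradient from a rate bound

Crux stmt-NavierStokesRegularity-11717 (route RellichScar), helper file (`--supports`) for the registered stub
`stub_vorticityDefectDecay`.  With `A_ij = ∂ᵢw_j − ∂ⱼw_i`, `w = V₁ − V₂`: (i) `DᵏA_ij(s,x) → 0` as `s ↑ 0` for
`x ≠ 0` (global cubic flatness of part 1: `‖DᵏA_ij‖ ≤ 2‖Dᵏ⁺¹w‖ ≤ 2W(−s)/‖x‖^{4+k}`,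
`tendsto_iteratedFDeriv_antisymGrad_twinDiff`); (ii) integration back from the final slice
(`norm_le_of_hasDerivAt_of_tendsto_zero`: `‖g′‖ ≤ M` on `[t,0)` and `g(s) → 0` give `‖g(t)‖ ≤ M(−t)`); (iii) GIVEN a
rate bound `‖∂ₜDᵏA_ij(s,x)‖ ≤ D(−s)/(‖x‖+√(−s))^{6+k}` (supplied by part 2, `…VorticityDefectDynamics`), ONE constant
gives `‖DᵏA_ij(t,x)‖ ≤ K(−t)²/(‖x‖+√(−t))^{6+k}` on the whole slab (`vorticityDefect_flatness_of_rate`): off the apex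
`‖DᵏA_ij(t,x)‖ ≤ D(−t)²/‖x‖^{6+k}` and `‖x‖+√(−t) ≤ 2‖x‖` on the exterior; in the core
`‖DᵏA_ij‖ ≤ 2W(−t)/(‖x‖+√(−t))^{4+k}` and `(‖x‖+√(−t))² ≤ 4(−t)`.
-/

noncomputable section

open Set Filter Function MeasureTheory Metric TopologicalSpace
open scoped Topology ContDiff Laplacian InnerProductSpace RealInnerProductSpace
open Literature.Analysis.FluidPDE

set_option linter.dupNamespace false -- D-0017: `Summit.<S>.<S>.…` repeats the summit name by design

-- nested operator types
set_option maxSynthPendingDepth 4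

namespace Summit.NavierStokesRegularity.NavierStokesRegularity.Theorems.RellichScarScarRigidity

variable {V₁ V₂ : ℝ → EuclideanSpace ℝ (Fin 3) → EuclideanSpace ℝ (Fin 3)} {Q₁ Q₂ : ℝ → EuclideanSpace ℝ (Fin 3) → ℝ}

/-- **All derivatives of the antisymmetric gradient vanish at the final slice off the apex**:
`DᵏA_ij(s,x) → 0` as `s ↑ 0` for `x ≠ 0` (`‖DᵏA_ij‖ ≤ 2‖Dᵏ⁺¹w‖ ≤ 2W(−s)/‖x‖^{4+k}`). [folklore] -/
theorem tendsto_iteratedFDeriv_antisymGrad_twinDiff (hcl₁ : IsClassicalNSSolutionOn (Iio (0 : ℝ)) 1 0 V₁ Q₁)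
    (hcl₂ : IsClassicalNSSolutionOn (Iio (0 : ℝ)) 1 0 V₂ Q₂) (hB₁ : ScaleInvariantBounds V₁ Q₁)
    (hB₂ : ScaleInvariantBounds V₂ Q₂) (hF : FarDecay 3 V₁ V₂) (k : ℕ) {x : EuclideanSpace ℝ (Fin 3)} (hx : x ≠ 0) (i j : Fin 3) :
    Tendsto (fun s => iteratedFDeriv ℝ k (fun y => (fderiv ℝ (fun z => V₁ s z - V₂ s z) y (EuclideanSpace.single i (1 : ℝ))) j -
        (fderiv ℝ (fun z => V₁ s z - V₂ s z) y (EuclideanSpace.single j (1 : ℝ))) i) x) (𝓝[<] (0 : ℝ)) (𝓝 0) := by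
  obtain ⟨W, hW0, hW⟩ :=
    exists_global_cubic_flatness hcl₁.smooth_velocity hcl₂.smooth_velocity hB₁ hB₂ hF (k + 1)
  have hxpos : 0 < ‖x‖ := norm_pos_iff.2 hx
  have hxk : 0 < ‖x‖ ^ (4 + k) := pow_pos hxpos _
  rw [tendsto_zero_iff_norm_tendsto_zero]
  have hbound : ∀ᶠ s in 𝓝[<] (0 : ℝ), ‖iteratedFDeriv ℝ k (fun y => (fderiv ℝ (fun z => V₁ s z - V₂ s z) y (EuclideanSpace.single i (1 : ℝ))) j -
      (fderiv ℝ (fun z => V₁ s z - V₂ s z) y (EuclideanSpace.single j (1 : ℝ))) i) x‖ ≤ 2 * W * (-s) / ‖x‖ ^ (4 + k) := by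
    filter_upwards [self_mem_nhdsWithin] with s hs
    have hs' : s < 0 := hs
    have hw : ContDiff ℝ ∞ (fun z => V₁ s z - V₂ s z) :=
      (hcl₁.contDiff_velocity hs').sub (hcl₂.contDiff_velocity hs')
    have h1 := norm_iteratedFDeriv_antisymGrad_le hw i j k x
    have h2 := hW (k + 1) le_rfl s hs' x
    have hρ : ‖x‖ ^ (4 + k) ≤ (‖x‖ + Real.sqrt (-s)) ^ (3 + (k + 1)) := by
      rw [show 3 + (k + 1) = 4 + k by ring]
      exact pow_le_pow_left₀ hxpos.le (le_add_of_nonneg_right (Real.sqrt_nonneg _)) _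
    have h3 : W * (-s) / (‖x‖ + Real.sqrt (-s)) ^ (3 + (k + 1)) ≤ W * (-s) / ‖x‖ ^ (4 + k) :=
      div_le_div_of_nonneg_left (mul_nonneg hW0 (by linarith)) hxk hρ
    calc _ ≤ 2 * ‖iteratedFDeriv ℝ (k + 1) (fun z => V₁ s z - V₂ s z) x‖ := h1
      _ ≤ 2 * (W * (-s) / ‖x‖ ^ (4 + k)) := mul_le_mul_of_nonneg_left (h2.trans h3) zero_le_two
      _ = 2 * W * (-s) / ‖x‖ ^ (4 + k) := by ring
  have hlim : Tendsto (fun s : ℝ => 2 * W * (-s) / ‖x‖ ^ (4 + k)) (𝓝[<] (0 : ℝ)) (𝓝 0) := by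
    have hc : Continuous fun s : ℝ => 2 * W * (-s) / ‖x‖ ^ (4 + k) :=
      ((continuous_const.mul continuous_neg).div_const _)
    have := hc.tendsto 0
    rw [neg_zero, mul_zero, zero_div] at this
    exact this.mono_left nhdsWithin_le_nhds
  exact squeeze_zero' (Eventually.of_forall fun s => norm_nonneg _) hbound hlim

/-! ### Time integration back from the final slice -/

/-- **Integration back from the final slice.**  If `g` is differentiable on `[t, 0)` with `‖g′‖ ≤ M` there and
`g(s) → 0` as `s ↑ 0`, then `‖g(t)‖ ≤ M(−t)` (mean value inequality on `[t, s]`, then `s ↑ 0`). [folklore] -/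
theorem norm_le_of_hasDerivAt_of_tendsto_zero {E : Type*} [NormedAddCommGroup E] [NormedSpace ℝ E]
    {g g' : ℝ → E} {t M : ℝ} (ht : t < 0) (hM : 0 ≤ M) (hd : ∀ s ∈ Ico t 0, HasDerivAt g (g' s) s)
    (hb : ∀ s ∈ Ico t 0, ‖g' s‖ ≤ M) (h0 : Tendsto g (𝓝[<] (0 : ℝ)) (𝓝 0)) : ‖g t‖ ≤ M * (-t) := by
  have hev : ∀ᶠ s in 𝓝[<] (0 : ℝ), ‖g t‖ ≤ M * (-t) + ‖g s‖ := by
    filter_upwards [Ioo_mem_nhdsLT ht] with s hs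
    have hmvt : ‖g s - g t‖ ≤ M * ‖s - t‖ :=
      (convex_Ico t 0).norm_image_sub_le_of_norm_hasDerivWithin_le (fun σ hσ => (hd σ hσ).hasDerivWithinAt) hb
        (left_mem_Ico.2 ht) ⟨hs.1.le, hs.2⟩
    have habs : ‖s - t‖ ≤ -t := by
      rw [Real.norm_eq_abs, abs_of_nonneg (by linarith [hs.1])]
      linarith [hs.2]
    calc ‖g t‖ = ‖g s - (g s - g t)‖ := by rw [sub_sub_cancel]
      _ ≤ ‖g s‖ + ‖g s - g t‖ := norm_sub_le _ _
      _ ≤ ‖g s‖ + M * (-t) := by linarith [hmvt, mul_le_mul_of_nonneg_left habs hM]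
      _ = M * (-t) + ‖g s‖ := by ring
  have hlim : Tendsto (fun s => M * (-t) + ‖g s‖) (𝓝[<] (0 : ℝ)) (𝓝 (M * (-t) + ‖(0 : E)‖)) :=
    tendsto_const_nhds.add h0.norm
  rw [norm_zero, add_zero] at hlim
  exact ge_of_tendsto hlim hev

/-- **Quintic flatness of the antisymmetric gradient from a rate bound.**  If for every `s < 0`, `x`, `i`, `j` the
time line `σ ↦ DᵏA_ij(σ, x)` has at `s` a derivative of norm `≤ D(−s)/(‖x‖+√(−s))^{6+k}`, then ONE constant `K`
gives `‖DᵏA_ij(t,x)‖ ≤ K(−t)²/(‖x‖+√(−t))^{6+k}` on the whole slab: off the apex integrate back from the final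
slice (`‖DᵏA_ij(t,x)‖ ≤ D(−t)²/‖x‖^{6+k}`, and `‖x‖+√(−t) ≤ 2‖x‖` on the exterior); in the core
`‖DᵏA_ij‖ ≤ 2‖Dᵏ⁺¹w‖ ≤ 2W(−t)/(‖x‖+√(−t))^{4+k}` and `(‖x‖+√(−t))² ≤ 4(−t)`. [folklore] -/
theorem vorticityDefect_flatness_of_rate (hcl₁ : IsClassicalNSSolutionOn (Iio (0 : ℝ)) 1 0 V₁ Q₁)
    (hcl₂ : IsClassicalNSSolutionOn (Iio (0 : ℝ)) 1 0 V₂ Q₂) (hB₁ : ScaleInvariantBounds V₁ Q₁)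
    (hB₂ : ScaleInvariantBounds V₂ Q₂) (hF : FarDecay 3 V₁ V₂) (k : ℕ) {D : ℝ} (hD0 : 0 ≤ D)
    (hrate : ∀ s < 0, ∀ (x : EuclideanSpace ℝ (Fin 3)) (i j : Fin 3), ∃ Φ : EuclideanSpace ℝ (Fin 3) [×k]→L[ℝ] ℝ,
      HasDerivAt (fun σ => iteratedFDeriv ℝ k (fun y : EuclideanSpace ℝ (Fin 3) =>
          (fderiv ℝ (fun z => V₁ σ z - V₂ σ z) y (EuclideanSpace.single i (1 : ℝ))) j -
          (fderiv ℝ (fun z => V₁ σ z - V₂ σ z) y (EuclideanSpace.single j (1 : ℝ))) i) x) Φ s ∧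
        ‖Φ‖ ≤ D * (-s) / (‖x‖ + Real.sqrt (-s)) ^ (6 + k)) :
    ∃ K : ℝ, ∀ (i j : Fin 3), ∀ t < 0, ∀ x : EuclideanSpace ℝ (Fin 3),
      ‖iteratedFDeriv ℝ k (fun y : EuclideanSpace ℝ (Fin 3) =>
            (fderiv ℝ (fun z => V₁ t z - V₂ t z) y (EuclideanSpace.single i (1 : ℝ))) j -
            (fderiv ℝ (fun z => V₁ t z - V₂ t z) y (EuclideanSpace.single j (1 : ℝ))) i) x‖ ≤
        K * (-t) ^ 2 / (‖x‖ + Real.sqrt (-t)) ^ (6 + k) := by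
  obtain ⟨W, hW0, hW⟩ :=
    exists_global_cubic_flatness hcl₁.smooth_velocity hcl₂.smooth_velocity hB₁ hB₂ hF (k + 1)
  refine ⟨2 ^ (6 + k) * D + 8 * W, fun i j t ht x => ?_⟩
  have hσ : 0 < Real.sqrt (-t) := Real.sqrt_pos.2 (by linarith)
  have hnt : 0 < -t := by linarith
  set ρ : ℝ := ‖x‖ + Real.sqrt (-t) with hρ
  have hρ0 : 0 < ρ := by positivity
  have hρk : 0 < ρ ^ (6 + k) := pow_pos hρ0 _
  rcases le_or_gt (Real.sqrt (-t)) ‖x‖ with hx | hx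
  · -- exterior: time integration
    have hxpos : 0 < ‖x‖ := hσ.trans_le hx
    have hxk : 0 < ‖x‖ ^ (6 + k) := pow_pos hxpos _
    choose Φ hΦ using hrate
    set M : ℝ := D * (-t) / ‖x‖ ^ (6 + k) with hM
    have hM0 : 0 ≤ M := by rw [hM]; exact div_nonneg (mul_nonneg hD0 hnt.le) hxk.le
    have h1 : ‖iteratedFDeriv ℝ k (fun y : EuclideanSpace ℝ (Fin 3) =>
            (fderiv ℝ (fun z => V₁ t z - V₂ t z) y (EuclideanSpace.single i (1 : ℝ))) j -
            (fderiv ℝ (fun z => V₁ t z - V₂ t z) y (EuclideanSpace.single j (1 : ℝ))) i) x‖ ≤ M * (-t) := by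
      refine norm_le_of_hasDerivAt_of_tendsto_zero
        (g := fun σ => iteratedFDeriv ℝ k (fun y : EuclideanSpace ℝ (Fin 3) =>
          (fderiv ℝ (fun z => V₁ σ z - V₂ σ z) y (EuclideanSpace.single i (1 : ℝ))) j -
          (fderiv ℝ (fun z => V₁ σ z - V₂ σ z) y (EuclideanSpace.single j (1 : ℝ))) i) x)
        (g' := fun s => if hs : s < 0 then Φ s hs x i j else 0) ht hM0
        (fun s hs => ?_) (fun s hs => ?_)
        (tendsto_iteratedFDeriv_antisymGrad_twinDiff hcl₁ hcl₂ hB₁ hB₂ hF k (norm_pos_iff.1 hxpos) i j)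
      · simpa only [dif_pos hs.2] using (hΦ s hs.2 x i j).1
      · rw [dif_pos hs.2, hM]
        refine (hΦ s hs.2 x i j).2.trans ?_
        have hρ' : ‖x‖ ^ (6 + k) ≤ (‖x‖ + Real.sqrt (-s)) ^ (6 + k) :=
          pow_le_pow_left₀ hxpos.le (le_add_of_nonneg_right (Real.sqrt_nonneg _)) _
        calc D * (-s) / (‖x‖ + Real.sqrt (-s)) ^ (6 + k) ≤ D * (-s) / ‖x‖ ^ (6 + k) :=
              div_le_div_of_nonneg_left (mul_nonneg hD0 (by linarith [hs.2])) hxk hρ'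
          _ ≤ D * (-t) / ‖x‖ ^ (6 + k) :=
              div_le_div_of_nonneg_right (mul_le_mul_of_nonneg_left (by linarith [hs.1]) hD0) hxk.le
    have hpow : ρ ^ (6 + k) ≤ 2 ^ (6 + k) * ‖x‖ ^ (6 + k) := by
      rw [← mul_pow]
      exact pow_le_pow_left₀ hρ0.le (by rw [hρ]; linarith) _
    calc _ ≤ M * (-t) := h1
      _ = D * (-t) ^ 2 / ‖x‖ ^ (6 + k) := by rw [hM]; ring
      _ ≤ 2 ^ (6 + k) * D * (-t) ^ 2 / ρ ^ (6 + k) := by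
          rw [div_le_div_iff₀ hxk hρk]
          calc D * (-t) ^ 2 * ρ ^ (6 + k) ≤ D * (-t) ^ 2 * (2 ^ (6 + k) * ‖x‖ ^ (6 + k)) :=
                mul_le_mul_of_nonneg_left hpow (by positivity)
            _ = 2 ^ (6 + k) * D * (-t) ^ 2 * ‖x‖ ^ (6 + k) := by ring
      _ ≤ (2 ^ (6 + k) * D + 8 * W) * (-t) ^ 2 / ρ ^ (6 + k) := by
          refine div_le_div_of_nonneg_right (mul_le_mul_of_nonneg_right ?_ (by positivity)) hρk.le
          linarith [mul_nonneg (show (0 : ℝ) ≤ 8 by norm_num) hW0]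
  · -- core: the package
    have hw : ContDiff ℝ ∞ (fun z => V₁ t z - V₂ t z) :=
      (hcl₁.contDiff_velocity ht).sub (hcl₂.contDiff_velocity ht)
    have h1 := norm_iteratedFDeriv_antisymGrad_le hw i j k x
    have h2 := hW (k + 1) le_rfl t ht x
    have hρσ : ρ ^ 2 ≤ 4 * (-t) := by
      have : ρ ≤ 2 * Real.sqrt (-t) := by rw [hρ]; linarith
      calc ρ ^ 2 ≤ (2 * Real.sqrt (-t)) ^ 2 := pow_le_pow_left₀ hρ0.le this 2
        _ = 4 * (-t) := by rw [mul_pow, Real.sq_sqrt hnt.le]; norm_num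
    calc _ ≤ 2 * ‖iteratedFDeriv ℝ (k + 1) (fun z => V₁ t z - V₂ t z) x‖ := h1
      _ ≤ 2 * (W * (-t) / ρ ^ (3 + (k + 1))) := mul_le_mul_of_nonneg_left h2 zero_le_two
      _ = 2 * W * (-t) * ρ ^ 2 / ρ ^ (6 + k) := by
          rw [show 3 + (k + 1) = 4 + k by ring, eq_div_iff hρk.ne', show 6 + k = 2 + (4 + k) by ring, pow_add]
          field_simp
          ring
      _ ≤ 2 * W * (-t) * (4 * (-t)) / ρ ^ (6 + k) :=
          div_le_div_of_nonneg_right (mul_le_mul_of_nonneg_left hρσ (by positivity)) hρk.le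
      _ ≤ (2 ^ (6 + k) * D + 8 * W) * (-t) ^ 2 / ρ ^ (6 + k) := by
          refine div_le_div_of_nonneg_right ?_ hρk.le
          nlinarith [mul_nonneg (pow_nonneg (zero_le_two (α := ℝ)) (6 + k)) hD0, sq_nonneg t]

/-! ### Registered sub-goal -/

/-- **Registered helper stub `stub_vorticityDefectBoundsTools`** of `stub_vorticityDefectDecay` (crux
stmt-NavierStokesRegularity-11717, line `moment-conditioned-rellich`): all derivatives of the antisymmetric gradient
vanish at the final slice off the apex, and quintic flatness on the whole slab follows from a rate bound
`‖∂ₜDᵏA_ij(s,x)‖ ≤ D(−s)/(‖x‖+√(−s))^{6+k}`. [folklore] -/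
theorem stub_vorticityDefectBoundsTools :
    ∀ (V₁ V₂ : ℝ → EuclideanSpace ℝ (Fin 3) → EuclideanSpace ℝ (Fin 3))
      (Q₁ Q₂ : ℝ → EuclideanSpace ℝ (Fin 3) → ℝ),
      IsClassicalNSSolutionOn (Iio (0 : ℝ)) 1 0 V₁ Q₁ → IsClassicalNSSolutionOn (Iio (0 : ℝ)) 1 0 V₂ Q₂ →
      ScaleInvariantBounds V₁ Q₁ → ScaleInvariantBounds V₂ Q₂ → FarDecay 3 V₁ V₂ → ∀ k : ℕ,
      (∀ (x : EuclideanSpace ℝ (Fin 3)) (i j : Fin 3), x ≠ 0 →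
        Tendsto (fun s => iteratedFDeriv ℝ k (fun y : EuclideanSpace ℝ (Fin 3) =>
            (fderiv ℝ (fun z => V₁ s z - V₂ s z) y (EuclideanSpace.single i (1 : ℝ))) j -
            (fderiv ℝ (fun z => V₁ s z - V₂ s z) y (EuclideanSpace.single j (1 : ℝ))) i) x)
          (nhdsWithin (0 : ℝ) (Iio 0)) (nhds 0)) ∧
      (∀ D : ℝ, 0 ≤ D →
        (∀ s < 0, ∀ (x : EuclideanSpace ℝ (Fin 3)) (i j : Fin 3), ∃ Φ : EuclideanSpace ℝ (Fin 3) [×k]→L[ℝ] ℝ,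
          HasDerivAt (fun σ => iteratedFDeriv ℝ k (fun y : EuclideanSpace ℝ (Fin 3) =>
              (fderiv ℝ (fun z => V₁ σ z - V₂ σ z) y (EuclideanSpace.single i (1 : ℝ))) j -
              (fderiv ℝ (fun z => V₁ σ z - V₂ σ z) y (EuclideanSpace.single j (1 : ℝ))) i) x) Φ s ∧
            ‖Φ‖ ≤ D * (-s) / (‖x‖ + Real.sqrt (-s)) ^ (6 + k)) →
        ∃ K : ℝ, ∀ (i j : Fin 3), ∀ t < 0, ∀ x : EuclideanSpace ℝ (Fin 3),
          ‖iteratedFDeriv ℝ k (fun y : EuclideanSpace ℝ (Fin 3) =>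
              (fderiv ℝ (fun z => V₁ t z - V₂ t z) y (EuclideanSpace.single i (1 : ℝ))) j -
              (fderiv ℝ (fun z => V₁ t z - V₂ t z) y (EuclideanSpace.single j (1 : ℝ))) i) x‖ ≤
            K * (-t) ^ 2 / (‖x‖ + Real.sqrt (-t)) ^ (6 + k)) :=
  fun _V₁ _V₂ _Q₁ _Q₂ hcl₁ hcl₂ hB₁ hB₂ hF k =>
    ⟨fun _x i j hx => tendsto_iteratedFDeriv_antisymGrad_twinDiff hcl₁ hcl₂ hB₁ hB₂ hF k hx i j,
      fun _D hD0 hrate => vorticityDefect_flatness_of_rate hcl₁ hcl₂ hB₁ hB₂ hF k hD0 hrate⟩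

end Summit.NavierStokesRegularity.NavierStokesRegularity.Theorems.RellichScarScarRigidity

end
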